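import Literature.NumberTheory.PAdicHodge.BmaxPlusKerTheta
import Literature.NumberTheory.PAdicHodge.FontaineOmega
import HarnessLib

/-!
# `A_max` is `(ξ/p)`-adically separated and Fontaine's `t` is a non-zero-divisor on `A_max`

Topic `Literature/NumberTheory/PAdicHodge`; namespace `Literature.NumberTheory.PAdicHodge`. THEOREMS ONLY (no definition, no named
fact, no instance). Continuation of `BmaxPlusTheta` / `BmaxPlusKerTheta` / `BmaxPlusFrobeniusFixed` on Colmez's `A_max = B_max⁺(F)`
(`p`-adic completion of `B⁰_max = 𝔸_inf[ξ/p]`, `ω = ξ/p`, Fontaine's `t = log[ε] = tBmax`):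

* `mem_pow_of_forall_sub_omegaB_pow_mul_mem` / ★ `eq_zero_of_forall_exists_eq_omegaB_pow_mul` — **`⋂ₖ (ξ/p)^k A_max = 0`**
  (levelwise: an element of the polynomial ring `B⁰_max/p = (𝒪_{ℂ_F}/p)[ξ/p]` divisible by every power of the variable is `0`);
* ★ `eq_zero_of_mul_eq_zero_of_thetaBmaxPlus_ne_zero` — **every `a ∈ A_max` with `θ(a) ≠ 0` is a non-zero-divisor**
  (`a z = 0 ⇒ θ(z) = 0 ⇒ z ∈ (ξ/p)A_max ⇒ … ⇒ z ∈ ⋂ₖ (ξ/p)^k A_max = 0`);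
* `exists_tBmax_eq_omegaB_mul` — **`t = (ξ/p)·t₁` with `θ(t₁) = p·θ(([ε]−1)/ξ) ≠ 0`**, hence ★ `eq_zero_of_tBmax_mul_eq_zero` —
  **`t` is a non-zero-divisor on `A_max`**;
* `frobBmaxPlus_eq_self_of_tBmax_mul_eq` — **if `φx = px` and `p^k x = t·q` then `φq = q`** (`φ(tq) = p·t·φ(q)`, `p` and `t` regular):
  with `(A_max)^{φ=1} = ℤ_p` (`BmaxPlusFrobeniusFixed`) this reduces Fontaine's lemma `(A_max)^{φ=p} ∩ ker θ ⊆ ℚ_p·t` to the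
  `t`-divisibility `p^k x ∈ t·A_max` (Colmez's criterion "`t ∣ x ⇔ θ(φⁿx) = 0 ∀ n`"), see `BmaxPlusFontaineKernel`.

Brick B7 of the φ-road of line `kato_lever` (crux K★ `stmt-BirchSwinnertonDyer-22226`, memo
`Cruxes/StarredOptimalManinUnitFiveSeven/Lines/kato-lever-K2-phi-road.md`). Infrastructure only: BSD / K★ are not proved by this.

## References
* [Colmez1998Annals] P. Colmez, *Théorie d'Iwasawa des représentations de de Rham d'un corps local*, Ann. of Math. 148 (1998), §III.2–III.3.
* [FontaineAsterisque223III] J.-M. Fontaine, *Le corps des périodes p-adiques*, Astérisque 223 (1994), Exp. II §1.5.4, Exp. III §5.3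
  (Th. 5.3.7: `Fil¹ B_cris⁺ ∩ (B_cris⁺)^{φ=p} = ℚ_p t`).
* [BergerLaurent2002] L. Berger, *Représentations p-adiques et équations différentielles*, Invent. Math. 148 (2002), §1.2.
-/

noncomputable section

open WittVector Field ValuativeRel Polynomial Finset
open Literature.AlgebraicGeometry.Resolution

namespace Literature.NumberTheory.PAdicHodge

open Literature.NumberTheory.GaloisRepresentations
open Literature.NumberTheory.GaloisRepresentations.IsNonarchimedeanLocalField

variable {F : Type} [Field F] [ValuativeRel F] [TopologicalSpace F] [IsNonarchimedeanLocalField F]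
  [CharZero F] {p : ℕ} [Fact p.Prime] [Fact (¬ IsUnit (p : integerC F))]
  [IsAdicComplete (Ideal.span {(p : integerC F)}) (integerC F)]

/-! ### `⋂ₖ (ξ/p)^k·B⁰_max ⊆ ⋂ₙ pⁿ·B⁰_max` -/

/-- `(ξ/p)^k · y ∈ p·B⁰_max ⇒ y ∈ p·B⁰_max`. [cite: Colmez1998Annals, §III.2] -/
theorem mem_span_of_omegaB_pow_mul_mem (k : ℕ) :
    ∀ {y : bmaxZero F p}, omegaB ^ k * y ∈ Ideal.span {(p : bmaxZero F p)} → y ∈ Ideal.span {(p : bmaxZero F p)} := by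
  induction k with
  | zero => intro y hy; rwa [pow_zero, one_mul] at hy
  | succ k ih => intro y hy; rw [pow_succ, mul_assoc] at hy; exact mem_span_of_omegaB_mul_mem (ih hy)

/-- **An element of `B⁰_max` divisible by a power of `ξ/p` exceeding its degree, modulo `p`, is divisible by `p`**: if
`y − (ξ/p)^k r ∈ p·B⁰_max` for every `k` then `y ∈ p·B⁰_max` (compare coefficients in the polynomial ring `B⁰_max/p`).
[cite: Colmez1998Annals, §III.2] -/
theorem mem_span_of_forall_sub_omegaB_pow_mul_mem {y : bmaxZero F p}
    (hy : ∀ k : ℕ, ∃ r : bmaxZero F p, y - omegaB ^ k * r ∈ Ideal.span {(p : bmaxZero F p)}) :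
    y ∈ Ideal.span {(p : bmaxZero F p)} := by
  obtain ⟨q, rfl⟩ := exists_aeval_omegaB_eq y
  obtain ⟨r, hr⟩ := hy (q.natDegree + 1)
  obtain ⟨R, rfl⟩ := exists_aeval_omegaB_eq r
  have h1 : aeval (omegaB : bmaxZero F p) (q - X ^ (q.natDegree + 1) * R) ∈ Ideal.span {(p : bmaxZero F p)} := by
    rwa [map_sub, map_mul, map_pow, aeval_X]
  have h2 := mem_map_C_of_aeval_omegaB_mem_span h1
  refine aeval_omegaB_mem_span_of_mem_map_C ?_
  rw [Ideal.mem_map_C_iff] at h2 ⊢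
  intro j
  by_cases hj : j ≤ q.natDegree
  · have := h2 j
    rwa [coeff_sub, coeff_X_pow_mul', if_neg (by omega), sub_zero] at this
  · rw [Polynomial.coeff_eq_zero_of_natDegree_lt (not_le.1 hj)]
    exact Submodule.zero_mem _

/-- **`y − (ξ/p)^k rₖ ∈ pⁿ·B⁰_max` for all `k` forces `y ∈ pⁿ·B⁰_max`.** [cite: Colmez1998Annals, §III.2] -/
theorem mem_pow_of_forall_sub_omegaB_pow_mul_mem (n : ℕ) :
    ∀ {y : bmaxZero F p}, (∀ k : ℕ, ∃ r : bmaxZero F p, y - omegaB ^ k * r ∈ Ideal.span {(p : bmaxZero F p)} ^ n) →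
      y ∈ Ideal.span {(p : bmaxZero F p)} ^ n := by
  induction n with
  | zero => intro y _; rw [pow_zero, Ideal.one_eq_top]; exact Submodule.mem_top
  | succ n ih =>
    intro y hy
    -- `y ∈ p·B⁰_max`
    have hy1 : y ∈ Ideal.span {(p : bmaxZero F p)} := by
      refine mem_span_of_forall_sub_omegaB_pow_mul_mem fun k => ?_
      obtain ⟨r, hr⟩ := hy k
      exact ⟨r, Ideal.pow_le_self (I := Ideal.span {(p : bmaxZero F p)}) (Nat.succ_ne_zero n) hr⟩
    rw [Ideal.mem_span_singleton'] at hy1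
    obtain ⟨y', rfl⟩ := hy1
    -- `y' − (ξ/p)^k r'ₖ ∈ pⁿ`
    have hy' : ∀ k : ℕ, ∃ r : bmaxZero F p, y' - omegaB ^ k * r ∈ Ideal.span {(p : bmaxZero F p)} ^ n := by
      intro k
      obtain ⟨r, hr⟩ := hy k
      -- `(ξ/p)^k r ∈ p·B⁰_max`, so `r = p r'`
      have hr1 : omegaB ^ k * r ∈ Ideal.span {(p : bmaxZero F p)} := by
        have h2 : y' * (p : bmaxZero F p) - omegaB ^ k * r ∈ Ideal.span {(p : bmaxZero F p)} :=
          Ideal.pow_le_self (I := Ideal.span {(p : bmaxZero F p)}) (Nat.succ_ne_zero n) hr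
        have h3 : y' * (p : bmaxZero F p) ∈ Ideal.span {(p : bmaxZero F p)} := Ideal.mul_mem_left _ _ (Ideal.mem_span_singleton_self _)
        have := Submodule.sub_mem _ h3 h2
        rwa [sub_sub_cancel] at this
      have hr2 := mem_span_of_omegaB_pow_mul_mem k hr1
      rw [Ideal.mem_span_singleton'] at hr2
      obtain ⟨r', rfl⟩ := hr2
      refine ⟨r', ?_⟩
      have hr3 := hr
      rw [Ideal.span_singleton_pow, Ideal.mem_span_singleton'] at hr3
      obtain ⟨w, hw⟩ := hr3
      rw [Ideal.span_singleton_pow, Ideal.mem_span_singleton']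
      refine ⟨w, eq_of_natCast_pow_mul_eq (p := p) (F := F) (v := 1) ?_⟩
      rw [pow_one]
      linear_combination hw
    have h5 := ih hy'
    rw [Ideal.span_singleton_pow, Ideal.mem_span_singleton'] at h5
    obtain ⟨w', hw'⟩ := h5
    rw [Ideal.span_singleton_pow, Ideal.mem_span_singleton']
    exact ⟨w', by rw [pow_succ, ← mul_assoc, hw']⟩

/-! ### `⋂ₖ (ξ/p)^k·A_max = 0` -/

set_option maxHeartbeats 1600000 in
/-- ★ **`A_max` is `(ξ/p)`-adically separated**: an element of `A_max = B_max⁺(F)` divisible by every power of `ξ/p` vanishes.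
[cite: Colmez1998Annals, §III.2] -/
theorem eq_zero_of_forall_exists_eq_omegaB_pow_mul {z : BmaxPlus F p}
    (hz : ∀ k : ℕ, ∃ zk : BmaxPlus F p, z = algebraMap (bmaxZero F p) (BmaxPlus F p) omegaB ^ k * zk) : z = 0 := by
  refine AdicCompletion.ext_evalₐ fun n => ?_
  obtain ⟨y, hy⟩ := Ideal.Quotient.mk_surjective (AdicCompletion.evalₐ (Ideal.span {(p : bmaxZero F p)}) n z)
  rw [map_zero, ← hy]
  refine Ideal.Quotient.eq_zero_iff_mem.2 (mem_pow_of_forall_sub_omegaB_pow_mul_mem n fun k => ?_)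
  obtain ⟨zk, hzk⟩ := hz k
  obtain ⟨r, hr⟩ := Ideal.Quotient.mk_surjective (AdicCompletion.evalₐ (Ideal.span {(p : bmaxZero F p)}) n zk)
  have h1 : AdicCompletion.evalₐ (Ideal.span {(p : bmaxZero F p)}) n (algebraMap (bmaxZero F p) (BmaxPlus F p) omegaB) =
      Ideal.Quotient.mk (Ideal.span {(p : bmaxZero F p)} ^ n) omegaB := AdicCompletion.evalₐ_of _ n _
  have h2 : Ideal.Quotient.mk (Ideal.span {(p : bmaxZero F p)} ^ n) y =
      Ideal.Quotient.mk (Ideal.span {(p : bmaxZero F p)} ^ n) (omegaB ^ k * r) :=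
    calc Ideal.Quotient.mk (Ideal.span {(p : bmaxZero F p)} ^ n) y
        = AdicCompletion.evalₐ (Ideal.span {(p : bmaxZero F p)}) n z := hy
      _ = AdicCompletion.evalₐ (Ideal.span {(p : bmaxZero F p)}) n (algebraMap (bmaxZero F p) (BmaxPlus F p) omegaB ^ k * zk) :=
          congrArg _ hzk
      _ = AdicCompletion.evalₐ (Ideal.span {(p : bmaxZero F p)}) n (algebraMap (bmaxZero F p) (BmaxPlus F p) omegaB ^ k) *
            AdicCompletion.evalₐ (Ideal.span {(p : bmaxZero F p)}) n zk := map_mul _ _ _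
      _ = AdicCompletion.evalₐ (Ideal.span {(p : bmaxZero F p)}) n (algebraMap (bmaxZero F p) (BmaxPlus F p) omegaB) ^ k *
            AdicCompletion.evalₐ (Ideal.span {(p : bmaxZero F p)}) n zk := by rw [map_pow]
      _ = Ideal.Quotient.mk (Ideal.span {(p : bmaxZero F p)} ^ n) omegaB ^ k *
            Ideal.Quotient.mk (Ideal.span {(p : bmaxZero F p)} ^ n) r := congrArg₂ (fun a b => a ^ k * b) h1 hr.symm
      _ = Ideal.Quotient.mk (Ideal.span {(p : bmaxZero F p)} ^ n) (omegaB ^ k * r) := by rw [← map_pow, ← map_mul]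
  exact ⟨r, (Ideal.Quotient.eq).1 h2⟩

/-! ### Elements with `θ(a) ≠ 0` are non-zero-divisors on `A_max` -/

set_option maxHeartbeats 1600000 in
/-- `(ξ/p)^k` is a non-zero-divisor on `A_max`. [cite: Colmez1998Annals, §III.2] -/
theorem eq_zero_of_omegaB_pow_mul_eq_zero (k : ℕ) :
    ∀ {z : BmaxPlus F p}, algebraMap (bmaxZero F p) (BmaxPlus F p) omegaB ^ k * z = 0 → z = 0 := by
  induction k with
  | zero => intro z hz; rwa [pow_zero, one_mul] at hz
  | succ k ih => intro z hz; rw [pow_succ, mul_assoc] at hz; exact eq_zero_of_omegaB_mul_eq_zero (ih hz)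

set_option maxHeartbeats 1600000 in
/-- ★ **Every `a ∈ A_max` with `θ(a) ≠ 0` is a non-zero-divisor on `A_max`**: if `a z = 0` then `θ(z) = 0`, so `z = (ξ/p) z₁` with
`a z₁ = 0` again; inductively `z ∈ ⋂ₖ (ξ/p)^k A_max = 0`. [cite: Colmez1998Annals, §III.2] -/
theorem eq_zero_of_mul_eq_zero_of_thetaBmaxPlus_ne_zero (hF : Function.Surjective (fontaineTheta (integerC F) p))
    {a : BmaxPlus F p} (ha : thetaBmaxPlus F p a ≠ 0) {z : BmaxPlus F p} (hz : a * z = 0) : z = 0 := by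
  refine eq_zero_of_forall_exists_eq_omegaB_pow_mul fun k => ?_
  induction k with
  | zero => exact ⟨z, by rw [pow_zero, one_mul]⟩
  | succ k ih =>
    obtain ⟨zk, hzk⟩ := ih
    have h1 : a * zk = 0 := by
      refine eq_zero_of_omegaB_pow_mul_eq_zero k ?_
      rw [← mul_assoc, mul_comm _ a, mul_assoc, ← hzk, hz]
    have h2 : thetaBmaxPlus F p zk = 0 := by
      have h3 := congrArg (thetaBmaxPlus F p) h1
      rw [map_mul, map_zero] at h3
      exact (mul_eq_zero.1 h3).resolve_left ha
    obtain ⟨z', hz'⟩ := exists_eq_omegaB_mul_of_thetaBmaxPlus_eq_zero hF h2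
    exact ⟨z', by rw [hzk, hz', pow_succ, mul_assoc]⟩

/-- **`p` is a non-zero-divisor on `A_max`.** [cite: Colmez1998Annals, §III.2] -/
theorem eq_zero_of_natCast_mul_eq_zero' (hF : Function.Surjective (fontaineTheta (integerC F) p)) {z : BmaxPlus F p}
    (hz : (p : BmaxPlus F p) * z = 0) : z = 0 := by
  refine eq_zero_of_mul_eq_zero_of_thetaBmaxPlus_ne_zero hF (a := (p : BmaxPlus F p)) ?_ hz
  rw [map_natCast]
  exact natCast_integerC_ne_zero (F := F) (Fact.out : p.Prime).ne_zero

/-- **`p^k` is a non-zero-divisor on `A_max`.** [cite: Colmez1998Annals, §III.2] -/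
theorem eq_zero_of_natCast_pow_mul_eq_zero (hF : Function.Surjective (fontaineTheta (integerC F) p)) (k : ℕ) :
    ∀ {z : BmaxPlus F p}, (p : BmaxPlus F p) ^ k * z = 0 → z = 0 := by
  induction k with
  | zero => intro z hz; rwa [pow_zero, one_mul] at hz
  | succ k ih => intro z hz; rw [pow_succ, mul_assoc] at hz; exact eq_zero_of_natCast_mul_eq_zero' hF (ih hz)

/-! ### `t = (ξ/p)·t₁` with `θ(t₁) = p·θ(([ε]−1)/ξ) ≠ 0`; `t` is a non-zero-divisor -/

/-- `θ(([ε] − 1)/ξ) ≠ 0` (`[ε] − 1` is a uniformizer of `B_dR⁺`: tree `exists_uAinf_eq_xi_mul`). [cite: FontaineAsterisque223III, Exp. II §1.5.4] -/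
theorem fontaineTheta_uDivXi_ne_zero : fontaineTheta (integerC F) p (uDivXi : Ainf (p := p) F) ≠ 0 := by
  obtain ⟨c, hc, hθ⟩ := exists_uAinf_eq_xi_mul (F := F) (p := p)
  have hxi : (xi : Ainf (p := p) F) ≠ 0 := fun h => by
    have := congrArg WittVector.constantCoeff h
    rw [constantCoeff_xi, map_zero] at this
    exact pFlat_ne_zero this
  have h : (uDivXi : Ainf (p := p) F) = c := mul_left_cancel₀ hxi (by rw [xi_mul_uDivXi, hc])
  rwa [h]

/-- The partial sums of `t` with one factor `ξ/p` removed: `logSum N = (ξ/p) · L'_N` with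
`L'_N = Σ_{k<N} (−1)^k c_{k+1} w^{k+1} (ξ/p)^k`. [cite: FontaineAsterisque223III, Exp. II §1.5.4] -/
theorem logSum_eq_omegaB_mul (N : ℕ) :
    logSum (F := F) (p := p) N = omegaB * ∑ k ∈ range N,
      (-1) ^ (k + 2) * algebraMap (Ainf (p := p) F) (bmaxZero F p) (zpToAinf (logCoeff p (k + 1)) * uDivXi ^ (k + 1)) * omegaB ^ k := by
  rw [logSum, mul_sum]
  refine sum_congr rfl fun k _ => ?_
  rw [logTerm, pow_succ]; ring

/-- `θ(L'_N) = p·θ(w)` for `N ≥ 1` (only the term `k = 0` survives `θ`, and `c_1 = p`). [cite: FontaineAsterisque223III, Exp. II §1.5.4] -/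
theorem thetaBmaxZero_logSum_div {N : ℕ} (hN : 1 ≤ N) :
    thetaBmaxZero F p (∑ k ∈ range N,
      (-1) ^ (k + 2) * algebraMap (Ainf (p := p) F) (bmaxZero F p) (zpToAinf (logCoeff p (k + 1)) * uDivXi ^ (k + 1)) * omegaB ^ k) =
      (p : integerC F) * fontaineTheta (integerC F) p uDivXi := by
  obtain ⟨M, rfl⟩ := Nat.exists_eq_add_of_le hN
  rw [map_sum, add_comm, sum_range_succ', sum_eq_zero fun k _ => ?_]
  · have hc1 : logCoeff p 1 = (p : ℤ_[p]) := by
      have h := natCast_mul_logCoeff (p := p) (k := 1) one_ne_zero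
      rwa [Nat.cast_one, one_mul, pow_one] at h
    rw [zero_add, pow_zero, mul_one, zero_add, map_mul, map_pow, map_neg, map_one, thetaBmaxZero_algebraMap, map_mul, hc1,
      map_natCast, map_natCast, pow_one]
    ring
  · rw [map_mul, map_pow, thetaBmaxZero_omegaB, zero_pow (Nat.succ_ne_zero k), mul_zero]

set_option maxHeartbeats 1600000 in
/-- **`t = (ξ/p)·t₁` with `θ(t₁) = p·θ(([ε]−1)/ξ)`** (in particular `θ(t₁) ≠ 0`). [cite: Colmez1998Annals, §III.2] [cite: FontaineAsterisque223III, Exp. II §1.5.4] -/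
theorem exists_tBmax_eq_omegaB_mul (hF : Function.Surjective (fontaineTheta (integerC F) p)) :
    ∃ t₁ : BmaxPlus F p, tBmax (F := F) (p := p) = algebraMap (bmaxZero F p) (BmaxPlus F p) omegaB * t₁ ∧
      thetaBmaxPlus F p t₁ = (p : integerC F) * fontaineTheta (integerC F) p uDivXi := by
  have h0 : thetaBmaxPlus F p (tBmax (F := F) (p := p)) = 0 := thetaBmaxPlus_tBmax
  obtain ⟨t₁, ht⟩ := exists_eq_omegaB_mul_of_thetaBmaxPlus_eq_zero hF h0
  refine ⟨t₁, ht, ?_⟩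
  rw [← sub_eq_zero]
  refine eq_zero_of_forall_mem_span_pow (p := p) fun n => ?_
  rcases Nat.eq_zero_or_pos n with rfl | hn
  · rw [pow_zero, Ideal.one_eq_top]; exact Submodule.mem_top
  -- level `n`: `t₁ ≡ L'_{pⁿ−1} (mod pⁿ)` because `(ξ/p)(t₁ − L') ≡ t − logSum ≡ 0` and `ξ/p` is a non-zero-divisor mod `pⁿ`
  obtain ⟨s, hs⟩ := Ideal.Quotient.mk_surjective (AdicCompletion.evalₐ (Ideal.span {(p : bmaxZero F p)}) n t₁)
  have h1 : AdicCompletion.evalₐ (Ideal.span {(p : bmaxZero F p)}) n (algebraMap (bmaxZero F p) (BmaxPlus F p) omegaB) =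
      Ideal.Quotient.mk (Ideal.span {(p : bmaxZero F p)} ^ n) omegaB := AdicCompletion.evalₐ_of _ n _
  obtain ⟨L', hL'⟩ : ∃ L' : bmaxZero F p, L' = ∑ k ∈ range (p ^ n - 1),
      (-1) ^ (k + 2) * algebraMap (Ainf (p := p) F) (bmaxZero F p) (zpToAinf (logCoeff p (k + 1)) * uDivXi ^ (k + 1)) * omegaB ^ k :=
    ⟨_, rfl⟩
  have hlog : logSum (F := F) (p := p) (p ^ n - 1) = omegaB * L' := by rw [hL']; exact logSum_eq_omegaB_mul _
  have h2 : Ideal.Quotient.mk (Ideal.span {(p : bmaxZero F p)} ^ n) (omegaB * s) =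
      Ideal.Quotient.mk (Ideal.span {(p : bmaxZero F p)} ^ n) (omegaB * L') :=
    calc Ideal.Quotient.mk (Ideal.span {(p : bmaxZero F p)} ^ n) (omegaB * s)
        = Ideal.Quotient.mk (Ideal.span {(p : bmaxZero F p)} ^ n) omegaB * Ideal.Quotient.mk (Ideal.span {(p : bmaxZero F p)} ^ n) s :=
          map_mul _ _ _
      _ = AdicCompletion.evalₐ (Ideal.span {(p : bmaxZero F p)}) n (algebraMap (bmaxZero F p) (BmaxPlus F p) omegaB) *
            AdicCompletion.evalₐ (Ideal.span {(p : bmaxZero F p)}) n t₁ := congrArg₂ (· * ·) h1.symm hs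
      _ = AdicCompletion.evalₐ (Ideal.span {(p : bmaxZero F p)}) n (algebraMap (bmaxZero F p) (BmaxPlus F p) omegaB * t₁) :=
          (map_mul _ _ _).symm
      _ = AdicCompletion.evalₐ (Ideal.span {(p : bmaxZero F p)}) n tBmax := congrArg _ ht.symm
      _ = Ideal.Quotient.mk (Ideal.span {(p : bmaxZero F p)} ^ n) (logSum (p ^ n - 1)) := evalₐ_tBmax n
      _ = Ideal.Quotient.mk (Ideal.span {(p : bmaxZero F p)} ^ n) (omegaB * L') := congrArg _ hlog
  have h3 : omegaB * (s - L') ∈ Ideal.span {(p : bmaxZero F p)} ^ n := by rw [mul_sub]; exact (Ideal.Quotient.eq).1 h2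
  have h4 : s - L' ∈ Ideal.span {(p : bmaxZero F p)} ^ n := mem_span_pow_of_omegaB_mul_mem n h3
  have h5 := thetaBmaxPlus_sub_mem_of_evalₐ_eq hs.symm
  have h6 := thetaBmaxZero_mem_pow_of_mem h4
  rw [map_sub, hL', thetaBmaxZero_logSum_div (Nat.one_le_iff_ne_zero.2 (Nat.sub_ne_zero_of_lt (Nat.one_lt_pow hn.ne' (Fact.out : p.Prime).one_lt)))] at h6
  have : thetaBmaxPlus F p t₁ - (p : integerC F) * fontaineTheta (integerC F) p uDivXi =
      (thetaBmaxPlus F p t₁ - thetaBmaxZero F p s) + (thetaBmaxZero F p s - (p : integerC F) * fontaineTheta (integerC F) p uDivXi) := by ring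
  rw [this]
  exact Submodule.add_mem _ h5 h6

/-- ★ **`t` is a non-zero-divisor on `A_max = B_max⁺(F)`**: `t z = 0 ⇒ z = 0` (`t = (ξ/p) t₁`, `ξ/p` regular, `θ(t₁) = pθ(w) ≠ 0`).
[cite: Colmez1998Annals, §III.2] -/
theorem eq_zero_of_tBmax_mul_eq_zero (hF : Function.Surjective (fontaineTheta (integerC F) p)) {z : BmaxPlus F p}
    (hz : tBmax (F := F) (p := p) * z = 0) : z = 0 := by
  obtain ⟨t₁, ht, hθ⟩ := exists_tBmax_eq_omegaB_mul hF
  have h1 : t₁ * z = 0 := by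
    refine eq_zero_of_omegaB_mul_eq_zero ?_
    rw [← mul_assoc, ← ht, hz]
  refine eq_zero_of_mul_eq_zero_of_thetaBmaxPlus_ne_zero hF ?_ h1
  rw [hθ]
  exact mul_ne_zero (natCast_integerC_ne_zero (F := F) (Fact.out : p.Prime).ne_zero) fontaineTheta_uDivXi_ne_zero

/-! ### `φx = px`, `p^k x = t q ⇒ φq = q` -/

set_option maxHeartbeats 1600000 in
/-- **If `p^k x = t·q` with `φx = px` then `φq = q`** (`φt = pt`, `p` and `t` regular on `A_max`). [cite: Colmez1998Annals, §III.3] -/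
theorem frobBmaxPlus_eq_self_of_tBmax_mul_eq (hF : Function.Surjective (fontaineTheta (integerC F) p)) {x q : BmaxPlus F p} {k : ℕ}
    (hx : frobBmaxPlus F p x = (p : BmaxPlus F p) * x) (hq : (p : BmaxPlus F p) ^ k * x = tBmax * q) :
    frobBmaxPlus F p q = q := by
  -- `φ(p^k x) = p^k · p · x = p · t · q` and `φ(t q) = p · t · φ(q)`
  have e1 : frobBmaxPlus F p ((p : BmaxPlus F p) ^ k * x) = (p : BmaxPlus F p) ^ k * ((p : BmaxPlus F p) * x) := by
    rw [map_mul, map_pow, map_natCast, hx]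
  have e2 : frobBmaxPlus F p (tBmax * q) = (p : BmaxPlus F p) * tBmax * frobBmaxPlus F p q := by
    rw [map_mul, frobBmaxPlus_tBmax, map_natCast]
  have E : (p : BmaxPlus F p) ^ k * ((p : BmaxPlus F p) * x) = (p : BmaxPlus F p) * tBmax * frobBmaxPlus F p q :=
    e1.symm.trans ((congrArg (frobBmaxPlus F p) hq).trans e2)
  have h4 : (p : BmaxPlus F p) * (tBmax * (frobBmaxPlus F p q - q)) = 0 := by
    linear_combination (-1 : BmaxPlus F p) * E + (p : BmaxPlus F p) * hq
  have h3 : tBmax * (frobBmaxPlus F p q - q) = 0 := eq_zero_of_natCast_mul_eq_zero' hF h4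
  exact sub_eq_zero.1 (eq_zero_of_tBmax_mul_eq_zero hF h3)

set_option maxHeartbeats 1600000 in
/-- **The converse inclusion `ℚ_p·t ⊆ (A_max)^{φ=p} ∩ ker θ`** (unconditional): `c·t` satisfies `φ(ct) = p·ct` and `θ(ct) = 0`.
[cite: FontaineAsterisque223III, Exp. II §1.5.4] -/
theorem frobBmaxPlus_zpToAinf_mul_tBmax (c : ℤ_[p]) :
    frobBmaxPlus F p (ainfToBmaxPlus F p (zpToAinf c) * tBmax) = (p : BmaxPlus F p) * (ainfToBmaxPlus F p (zpToAinf c) * tBmax) ∧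
      thetaBmaxPlus F p (ainfToBmaxPlus F p (zpToAinf c) * tBmax) = 0 := by
  refine ⟨?_, thetaBmaxPlus_ainfToBmaxPlus_mul_tBmax _⟩
  rw [map_mul, frobBmaxPlus_ainfToBmaxPlus, frobenius_zpToAinf, frobBmaxPlus_tBmax, map_natCast]
  ring

end Literature.NumberTheory.PAdicHodge

end
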